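import Summits.RiemannHypothesis.RiemannHypothesis.Theorems.GroundBartaEvenWinsBeyondArchDeflationPSDFromBounds
import HarnessLib

/-!
# RiemannHypothesis / GroundBarta — rung 4: the sigma-criterion matrix is PSD from Markov-free entry bounds
# (monotonicity in the killing constant)

Helper file (`--supports`), RH-free.  Prover A (gen 2).

In `N_ij = (β − λ)(A_ij − λ G_ij) − δ_ij τ θ_i` the A-layer entry is `A_ij = A'_ij − M_c G_ij` with `A' = P₂ + 𝓔₂`
certified to `10⁻²⁷` but `M_c` only to `8·10⁻¹⁵` (the `γ` bracket).  Since `G` is positive semidefinite and `β > λ`,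
`N` is antitone in `M_c`: it suffices to certify the matrix with `M_c` replaced by any upper bound `Mhi ≥ M_c`
(`dt_hN_of_boundsT`).  The positivity of the exact rational Gram matrix `G` is supplied by an exact `LᵀDL` factorisation
(`dt_psd_of_scaledCertificate` with zero radii).
-/

set_option linter.dupNamespace false

noncomputable section

open Finset
open scoped BigOperators

namespace Summit.RiemannHypothesis.RiemannHypothesis.Theorems.EvenWinsBeyondArch

/-- **`hN` from Markov-free entry bounds.**  `Tlo ≤ A'_ij ≤ Thi` (rational), exact `G` with an exact PSD factorisation
`G = L_Gᵀ diag(D_G) L_G`, `M ≤ Mhi`, `β ∈ [βlo, βhi]`, and the kernel certificate `nCheck₂` for the entries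
`A'_ij − Mhi G_ij`: then `∀ α, 0 ≤ Σ α_i α_j ((β−λ)((A'_ij − M G_ij) − λ G_ij) − δ_ij τ θ_i)`. [folklore] -/
theorem dt_hN_of_boundsT {k m mG : ℕ} (Ap : Fin k → Fin k → ℝ) (Tlo Thi G : Fin k → Fin k → ℚ)
    (hAp : ∀ i j, (Tlo i j : ℝ) ≤ Ap i j ∧ Ap i j ≤ (Thi i j : ℝ)) (Gr : Fin k → Fin k → ℝ) (hG : ∀ i j, Gr i j = G i j)
    {M : ℝ} (Mhi : ℚ) (hM : M ≤ (Mhi : ℝ))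
    (DG : Fin mG → ℚ) (LG : Fin mG → Fin k → ℚ) (hDG : ∀ r, 0 ≤ DG r)
    (hLG : ∀ i j, G i j = 0 * (if i = j then 1 else 0) + ∑ r, DG r * LG r i * LG r j)
    {β : ℝ} (βlo βhi : ℚ) (hβ : (βlo : ℝ) ≤ β ∧ β ≤ (βhi : ℝ))
    (lam τ : ℚ) (θ s : Fin k → ℚ) (P E : Fin k → Fin k → ℚ) (D : Fin m → ℚ) (L : Fin m → Fin k → ℚ) (δ : ℚ)
    (hchk : nCheck₂ βlo βhi lam τ θ s (fun i j ↦ Tlo i j - Mhi * G i j) (fun i j ↦ Thi i j - Mhi * G i j) G P E = true)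
    (hrow : ∀ i, ∑ j, E i j ≤ δ) (hcol : ∀ j, ∑ i, E i j ≤ δ)
    (hD : ∀ r, 0 ≤ D r) (hP : ∀ i j, P i j = δ * (if i = j then 1 else 0) + ∑ r, D r * L r i * L r j)
    (α : Fin k → ℝ) :
    0 ≤ ∑ i, ∑ j, α i * α j *
      ((β - lam) * ((Ap i j - M * Gr i j) - (lam : ℝ) * Gr i j) - if i = j then (τ : ℝ) * θ i else 0) := by
  -- `λ < βlo ≤ β` is part of the check
  have hchk' := hchk
  unfold nCheck₂ at hchk'
  simp only [Bool.and_eq_true, decide_eq_true_eq] at hchk'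
  have hlamβ : (lam : ℝ) < β := lt_of_lt_of_le (by exact_mod_cast hchk'.1.1.1.1) hβ.1
  -- the certified matrix with `Mhi`
  have h1 := dt_hN_of_bounds₂ (fun i j ↦ Ap i j - (Mhi : ℝ) * Gr i j) (fun i j ↦ Tlo i j - Mhi * G i j)
    (fun i j ↦ Thi i j - Mhi * G i j) G
    (fun i j ↦ by
      obtain ⟨a1, a2⟩ := hAp i j
      rw [hG i j]; push_cast; constructor <;> linarith)
    Gr hG βlo βhi hβ lam τ θ s P E D L δ hchk hrow hcol hD hP α
  -- positivity of the Gram form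
  have hGpsd : 0 ≤ ∑ i, ∑ j, α i * α j * Gr i j := by
    have h := dt_psd_of_scaledCertificate (fun i j ↦ Gr i j) (fun _ ↦ (1 : ℚ)) (fun _ ↦ by norm_num) G
      (fun _ _ ↦ (0 : ℚ)) DG LG 0 (fun i j ↦ by rw [hG i j]; push_cast; simp) (fun i ↦ by simp) (fun j ↦ by simp) hDG hLG α
    simpa using h
  -- combine: N(M) = N(Mhi) + (β − λ)(Mhi − M) Σ αα G
  have hsplit : ∑ i, ∑ j, α i * α j *
        ((β - lam) * ((Ap i j - M * Gr i j) - (lam : ℝ) * Gr i j) - if i = j then (τ : ℝ) * θ i else 0) =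
      (∑ i, ∑ j, α i * α j *
        ((β - lam) * ((Ap i j - (Mhi : ℝ) * Gr i j) - (lam : ℝ) * Gr i j) - if i = j then (τ : ℝ) * θ i else 0)) +
      (β - lam) * ((Mhi : ℝ) - M) * ∑ i, ∑ j, α i * α j * Gr i j := by
    rw [Finset.mul_sum, ← Finset.sum_add_distrib]
    refine Finset.sum_congr rfl fun i _ ↦ ?_
    rw [Finset.mul_sum, ← Finset.sum_add_distrib]
    refine Finset.sum_congr rfl fun j _ ↦ ?_
    ring
  rw [hsplit]
  have h2 : 0 ≤ (β - lam) * ((Mhi : ℝ) - M) * ∑ i, ∑ j, α i * α j * Gr i j :=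
    mul_nonneg (mul_nonneg (by linarith) (by linarith)) hGpsd
  linarith

end Summit.RiemannHypothesis.RiemannHypothesis.Theorems.EvenWinsBeyondArch

end
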